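import Summits.Ventures.PackingBounds.Energy.NewtonCertificate

/-!
# Universal optimality of the regular simplices (`N ≤ n + 1` points on `S^{n-1}`, every `n ≥ 3`) —
Cohn–Kumar 2007, Thm. 1.2, in LP-certificate form; the bound for every `N`

Framing: lottery ticket; floor = certified bounds/negative ranges. Venture `PackingBounds` (cell
`pub-packcert`, seat `pub-packcert-energy`), energy-minimisation family, **universal + control**
(all dimensions `n ≥ 3`, all `N ≥ 2`, all potentials of the class at once).

**Theorem A (`ckPow_energy_ge`).** For `n ≥ 3`, `N ≥ 2`, every `k : ℕ` and every configuration `C`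
of `N` unit vectors of `ℝⁿ`: `Σ_{x ≠ y ∈ C} (1 + ⟨x,y⟩)^k ≥ N (N-1) (1 - 1/(N-1))^k`. For `N ≤ n + 1`
the right-hand side is the `(1+t)^k`-energy of the regular simplex with `N` vertices (all inner
products `-1/(N-1)`), the first two rows of Cohn–Kumar's Table 1; for larger `N` it is still a valid
(non-sharp) bound (the "tangent line" / Jensen bound).

**Theorem B (`universally_optimal`).** The same for every potential `a(s) = Σ_k c_k (1+s)^k`,
`c_k ≥ 0`, on `[-1,1)`: `Σ_{x ≠ y ∈ C} a(⟨x,y⟩) ≥ N (N-1) a(-1/(N-1))`. (The tree's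
`tangent_energy_ge`, `TangentLineUniversal.lean`, proves this under a supporting-line hypothesis; here
it is unconditional for the power-series class, and `UniversalOptimality.lean` restates it for
Mathlib's `AbsolutelyMonotoneOn`.)

Certificate (symbolic in `μ = n/2 - 1 > 0` and `N`): one node `u₀ = 1 - 1/(N-1) ≥ 0` doubled
(`D = 2`): `ω₀ = 1 = C_0`, `ω₁ = u - u₀ = (1/(N-1)) C_0 + (1/(2μ)) C_1^{(μ)}`, both positive definite,
and the two design identities (a simplex is a 1-design: centroid `0`); then `NewtonCert.energy_ge`.

## References
* H. Cohn, A. Kumar, *Universally optimal distribution of points on spheres*, J. Amer. Math. Soc.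
  20 (2007) 99–148, Thm. 1.2, Table 1 (first two rows), Prop. 4.1. [`CohnKumar2006`]
-/

noncomputable section

namespace Summit.Ventures.PackingBounds.Energy

open Finset Literature.Analysis.SpecialFunctions Literature.Geometry.DiscreteGeometry

namespace UniversalSimplex

open scoped Classical in
/-- **Theorem A.** For `n ≥ 3`, `N ≥ 2` and every `k`, every `N`-point configuration of unit vectors in
`ℝⁿ` has `Σ_{x ≠ y} (1 + ⟨x,y⟩)^k ≥ N (N - 1) (1 - 1/(N-1))^k` (the value of the regular simplex when
`N ≤ n + 1`). [cite: CohnKumar2006, Theorem 1.2, Table 1 and §6] -/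
theorem ckPow_energy_ge {n : ℕ} (hn : 3 ≤ n) {N : ℕ} (hN2 : 2 ≤ N) (k : ℕ)
    (C : Finset (EuclideanSpace ℝ (Fin n))) (h1 : ∀ x ∈ C, ‖x‖ = 1) (hN : C.card = N) :
    (N : ℝ) * (((N : ℝ) - 1) * (1 + (-1 / ((N : ℝ) - 1))) ^ k) ≤
      ∑ x ∈ C, ∑ y ∈ C.erase x, (1 + inner ℝ x y) ^ k := by
  have hn3 : (3 : ℝ) ≤ n := by exact_mod_cast hn
  have hN2' : (2 : ℝ) ≤ N := by exact_mod_cast hN2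
  obtain ⟨μ, hμ, hnμ⟩ : ∃ μ : ℝ, 0 < μ ∧ (n : ℝ) = 2 * μ + 2 :=
    ⟨((n : ℝ) - 2) / 2, by linarith, by ring⟩
  have hμ0 : μ ≠ 0 := hμ.ne'
  have hN1 : (0 : ℝ) < (N : ℝ) - 1 := by linarith
  have hN1' : (N : ℝ) - 1 ≠ 0 := hN1.ne'
  refine le_trans (le_of_eq ?val) (NewtonCert.energy_ge (n := n) (μ := μ) hnμ hμ 2 (by norm_num)
    -- the node u₀ = 1 - 1/(N-1), doubled
    (fun i : ℕ => match i with
      | 0 => (1 - 1 / ((N : ℝ) - 1) : ℝ) | 1 => 1 - 1 / ((N : ℝ) - 1) | _ => 0)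
    ?hv ?hsq
    -- Gegenbauer table of 1 and u - u₀
    (fun j i : ℕ => match j with
      | 0 => (match i with | 0 => (1 : ℝ) | _ => 0)
      | 1 => (match i with | 0 => (1 / ((N : ℝ) - 1) : ℝ) | 1 => 1 / (2 * μ) | _ => 0)
      | _ => 0)
    ?hG ?hGid N 1 (by norm_num)
    -- distance distribution: N - 1 neighbours at inner product -1/(N-1)
    (fun i : ℕ => match i with | 0 => ((N : ℝ) - 1 : ℝ) | _ => 0)
    ?hdes k C h1 hN)
  case hv =>
    intro i
    have h : 0 ≤ 1 - 1 / ((N : ℝ) - 1) := by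
      rw [sub_nonneg, div_le_one hN1]; linarith
    split <;> first | exact h | norm_num
  case hsq =>
    exact fun u _ => NewtonCert.omega_doubled_nonneg _ 1 (fun i hi => by
      interval_cases i; rfl) u
  case hG =>
    intro j i
    split <;> (first | (split <;> positivity) | norm_num)
  case hGid =>
    intro j hj t
    interval_cases j
    · simp only [Finset.prod_range_zero, Finset.sum_range_succ, Finset.sum_range_zero,
        gegenbauerSum_zero, gegenbauerSum_one]
      ring
    · simp only [Finset.prod_range_succ, Finset.prod_range_zero, Finset.sum_range_succ,
        Finset.sum_range_zero, gegenbauerSum_zero, gegenbauerSum_one]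
      field_simp
      ring
  case hdes =>
    intro j hj
    interval_cases j
    · simp only [Finset.prod_range_zero, Finset.sum_range_succ, Finset.sum_range_zero]
      ring
    · simp only [Finset.prod_range_succ, Finset.prod_range_zero, Finset.sum_range_succ,
        Finset.sum_range_zero]
      field_simp
      ring
  case val =>
    simp only [Finset.sum_range_succ, Finset.sum_range_zero]
    ring

open scoped Classical in
/-- **Theorem B (universal optimality of the regular simplices, Cohn–Kumar Thm. 1.2; the tangent-line
bound for every `N`).** For every potential `a` with `a(s) = Σ_k c_k (1+s)^k`, `c_k ≥ 0`, on `[-1,1)`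
(≡ absolutely monotonic on `[-1,1)`), every `N`-point configuration (`N ≥ 2`) of unit vectors in `ℝⁿ`
(`n ≥ 3`) has `Σ_{x ≠ y} a(⟨x,y⟩) ≥ N (N-1) a(-1/(N-1))`, with equality for the regular simplex when
`N ≤ n + 1`. [cite: CohnKumar2006, Theorem 1.2] -/
theorem universally_optimal {n : ℕ} (hn : 3 ≤ n) {N : ℕ} (hN2 : 2 ≤ N) (a : ℝ → ℝ) (c : ℕ → ℝ)
    (hc : ∀ k, 0 ≤ c k)
    (ha : ∀ s : ℝ, -1 ≤ s → s < 1 → HasSum (fun k => c k * (1 + s) ^ k) (a s))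
    (C : Finset (EuclideanSpace ℝ (Fin n))) (h1 : ∀ x ∈ C, ‖x‖ = 1) (hN : C.card = N) :
    (N : ℝ) * (((N : ℝ) - 1) * a (-1 / ((N : ℝ) - 1))) ≤
      ∑ x ∈ C, ∑ y ∈ C.erase x, a (inner ℝ x y) := by
  have hN2' : (2 : ℝ) ≤ N := by exact_mod_cast hN2
  have hN1 : (0 : ℝ) < (N : ℝ) - 1 := by linarith
  have key := NewtonCert.energy_ge_hasSum_of_pow (n := n) N 1
    (fun i : ℕ => match i with | 0 => (-1 / ((N : ℝ) - 1) : ℝ) | _ => 0)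
    (fun i : ℕ => match i with | 0 => ((N : ℝ) - 1 : ℝ) | _ => 0)
    (fun i hi => by
      interval_cases i
      refine ⟨?_, ?_⟩
      · show (-1 : ℝ) ≤ -1 / ((N : ℝ) - 1)
        rw [le_div_iff₀ hN1]; linarith
      · show -1 / ((N : ℝ) - 1) < 1
        rw [div_lt_one hN1]; linarith) C h1
    (fun k => by
      refine le_trans (le_of_eq ?_) (ckPow_energy_ge hn hN2 k C h1 hN)
      simp only [Finset.sum_range_succ, Finset.sum_range_zero]
      ring)
    a c hc ha
  refine le_trans (le_of_eq ?_) key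
  simp only [Finset.sum_range_succ, Finset.sum_range_zero]
  ring

end UniversalSimplex

end Summit.Ventures.PackingBounds.Energy

end
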